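import Literature.Computability.QuantumComplexity.ADHOracleWalk
import Literature.Computability.QuantumComplexity.AaronsonAmbainisMoments
import HarnessLib

/-!
# Aaronson–Ambainis 2014, Thm. 23 (machine half): the `FP` atoms of the counting formulas

For the polynomial-time implementation of the simulation of Thm. 23 (arXiv:0911.0996v3, p. 14)
the node quantities `E[p_ρ]`, `Vr[p_ρ]`, `Inf_i[p_ρ]` are written (`AaronsonAmbainisMoments.lean`)
as sums over tuples of GUESSED coin strings `c` of integer weights built from: the final state of
the guessed walk `tRunO` (validity, label, phase: the pair terms `tA`, `tB`), and the reads
(query index, guessed answer) of the oracle gates met along it (consistency `Cons`, `freeIdx`).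
This file supplies these data as polynomial-time string functions of the words `⟨x, c⟩` and
`⟨x, ⟨c, bin t⟩⟩` (the walk machine `finalO`/`walkO` of `ADHOracleWalk.lean`), with their values:

* coin streams: `tRunO`, `readsO`, `readsI` read the coins only through `c.getD t false`, `t < μ`
  (`tRunO_congr`, `readsI_congr`); for the numeral `bin v` these are the binary digits of `v`
  (`getD_encodeNat_eq`), and coin functions `c : Fin μ → Bool` are the numerals `v < 2^μ`
  (`sum_range_two_pow_eq_sum_fn`);
* `walkO_eq_iterate` (`min t |d|` rounds, every `t`), `eF_walkO_eq_nil_iff` (no gate ahead iff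
  `μ ≤ t`), the label/code of round `t` (`walkO_apply`);
* the atoms: `vldT` (validity), `labF` (label), `phkF k` (phase `+k mod 8`) of the final record;
  `liveT` (`t < μ`), `orcT` (gate `t` is an oracle gate), `hadT` (gate `t` is `H`), `coinT` (the
  coin = guessed answer at `t`), `qryF` (the query string at `t`, `OracleWalkMachine.qF`) and
  `idxF` (its canonical number `strNum`), each in `FP` for a uniform family and with its value on
  `⟨x, c⟩`, `⟨x, ⟨c, bin t⟩⟩` in terms of `tRunO`/the gate list.

No named facts.

## References

* S. Aaronson, A. Ambainis, *The need for structure in quantum speedups*, Theory Comput. 10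
  (2014), proof of Thm. 23 (arXiv:0911.0996v3, p. 14) [AaronsonAmbainis2014].
* S. Arora, B. Barak, *Computational Complexity: A Modern Approach*, CUP 2009, §1.3, §6.2.
-/

noncomputable section

namespace Literature.Computability.QuantumComplexity

namespace ADH

open _root_.Computability Polynomial Complexity Complexity.Brick Complexity.Plumb Cryptography

attribute [-simp] Brick.nthF_zero Brick.sndPow_zero

variable {N : ℕ}

/-! ### The walks read the coins positionally -/

/-- `headBit` reads position `0`. [folklore] -/
theorem headBit_eq_getD (cs : List Bool) : headBit cs = cs.getD 0 false := by
  cases cs <;> simp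

/-- Positions of the tail. [folklore] -/
theorem getD_tail (cs : List Bool) (t : ℕ) : cs.tail.getD t false = cs.getD (t + 1) false := by
  cases cs <;> simp

/-- **`tRunO` reads the coins only through `c.getD t`, `t < |gs|`.** [folklore] -/
theorem tRunO_congr : ∀ (gs : List (QGate cliffordT N)) (cs cs' : List Bool) (s : TState N),
    (∀ t < gs.length, cs.getD t false = cs'.getD t false) → tRunO gs cs s = tRunO gs cs' s
  | [], _, _, _, _ => rfl
  | g :: gs, cs, cs', s, h => by
    simp only [tRunO]
    rw [headBit_eq_getD, headBit_eq_getD, h 0 (by simp)]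
    exact tRunO_congr gs _ _ _ fun t ht => by rw [getD_tail, getD_tail]; exact h (t + 1) (by simpa using ht)

/-- **`readsO` reads the coins only through `c.getD t`, `t < |gs|`.** [folklore] -/
theorem readsO_congr : ∀ (gs : List (QGate cliffordT N)) (cs cs' : List Bool) (w : QReg N),
    (∀ t < gs.length, cs.getD t false = cs'.getD t false) → readsO gs cs w = readsO gs cs' w
  | [], _, _, _, _ => rfl
  | .gate g e :: gs, cs, cs', w, h => by
    simp only [readsO_gate]
    rw [headBit_eq_getD, headBit_eq_getD, h 0 (by simp)]
    exact readsO_congr gs _ _ _ fun t ht => by rw [getD_tail, getD_tail]; exact h (t + 1) (by simpa using ht)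
  | .oracle k e :: gs, cs, cs', w, h => by
    simp only [readsO_oracle]
    rw [headBit_eq_getD, headBit_eq_getD, h 0 (by simp)]
    rw [readsO_congr gs cs.tail cs'.tail _ fun t ht => by rw [getD_tail, getD_tail]; exact h (t + 1) (by simpa using ht)]

/-- The digits of a numeral are the binary digits of its value. [folklore] -/
theorem getD_encodeNat_eq (v t : ℕ) : (encodeNat v).getD t false = v.testBit t := by
  have h := Com.testBit_bitsToNat (encodeNat v) t
  rw [bitsToNat_encodeNat] at h
  exact h.symm

/-- `List.ofFn` read positionally. [folklore] -/
theorem getD_ofFn {μ : ℕ} (c : Fin μ → Bool) (t : ℕ) (ht : t < μ) : (List.ofFn c).getD t false = c ⟨t, ht⟩ := by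
  rw [List.getD_eq_getElem _ _ (by simpa using ht), List.getElem_ofFn]

/-- **Coin functions are numerals**: summing a function of `c : {0,1}^μ` read positionally is
summing over `v < 2^μ` with the binary digits of `v`. [folklore] -/
theorem sum_range_two_pow_eq_sum_fn {β : Type*} [AddCommMonoid β] (μ : ℕ) (G : (Fin μ → Bool) → β) :
    ∑ v ∈ Finset.range (2 ^ μ), G (fun t => v.testBit t) = ∑ c : Fin μ → Bool, G c := by
  classical
  let e : Fin (2 ^ μ) → (Fin μ → Bool) := fun v t => v.1.testBit t
  have hinj : Function.Injective e := by
    intro v v' h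
    apply Fin.ext
    apply Nat.eq_of_testBit_eq
    intro t
    by_cases ht : t < μ
    · exact congrFun h ⟨t, ht⟩
    · rw [Nat.testBit_lt_two_pow (v.2.trans_le (Nat.pow_le_pow_right (by norm_num) (not_lt.1 ht))),
        Nat.testBit_lt_two_pow (v'.2.trans_le (Nat.pow_le_pow_right (by norm_num) (not_lt.1 ht)))]
  have hbij : Function.Bijective e := (Fintype.bijective_iff_injective_and_card e).2 ⟨hinj, by simp⟩
  rw [← Fin.sum_univ_eq_sum_range (fun v => G fun t => v.testBit t) (2 ^ μ)]
  exact Fintype.sum_bijective e hbij _ _ fun v => rfl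

/-! ### The counted walk at every round count -/

/-- The run of the counted loop with a body ignoring yardstick and counter. [folklore] -/
theorem loopRun_comp_sndPow (f : List Bool → List Bool) (x : List Bool) :
    ∀ (n : ℕ) (c s : List Bool), loopRun (f ∘ sndPow 1) x c n s = f^[activeRounds c n] s
  | 0, c, s => rfl
  | n + 1, c, s => by
    unfold loopRun activeRounds
    split_ifs with hc
    · rfl
    · rw [loopRun_comp_sndPow f x n]
      simp only [Function.comp_apply, sndPow_succ_boolPair, Brick.sndPow_zero_boolPair]
      rw [← Function.iterate_succ_apply]

variable (F : QCircuitFamily cliffordT)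

/-- **The counted walk runs `min t |d|` rounds.** [folklore] -/
theorem walkO_eq_iterate (x co : List Bool) (t : ℕ) :
    walkO F (boolPair x (boolPair co (encodeNat t))) =
      roundO^[min t (F.descFn x).length] (rec6 (F.descFn x) (encList (codes F x)) co (List.ofFn (w₀ F x)) (ones 0) [true]) := by
  simp only [walkO, Function.comp_apply, walkInitF_apply, loopX_record, sndPow_succ_boolPair, Brick.sndPow_zero_boolPair,
    loopRun_comp_sndPow, activeRounds_encodeNat]

/-- **After `t ≥ μ` rounds no gate is ahead** (and the record holds the final state). [folklore] -/
theorem walkO_apply_of_le (x co : List Bool) {t : ℕ} (ht : (F.circ x.length).gates.length ≤ t) :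
    walkO F (boolPair x (boolPair co (encodeNat t))) =
      (let gs := (F.circ x.length).gates
       let r := tRunO gs co (w₀ F x, 0, true)
       rec6 (F.descFn x) [] (co.drop gs.length) (List.ofFn r.1) (ones r.2.1) [r.2.2]) := by
  rw [walkO_eq_iterate]
  exact iterate_roundO (F.descFn x) _ _ co (w₀ F x, 0, true)
    (le_min ht (length_gates_le_length_descFn F x))

/-- **No gate ahead iff `μ ≤ t`.** [folklore] -/
theorem eF_walkO_eq_nil_iff (x co : List Bool) (t : ℕ) :
    eF (walkO F (boolPair x (boolPair co (encodeNat t)))) = [] ↔ (F.circ x.length).gates.length ≤ t := by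
  constructor
  · intro h
    by_contra hlt
    rw [not_le] at hlt
    rw [walkO_apply F x co hlt.le] at h
    simp only [rec6, nthF, Function.comp_apply, fstF_boolPair, sndF_boolPair] at h
    rw [List.drop_eq_getElem_cons hlt, List.map_cons, encList_cons] at h
    exact absurd h (by simp [boolPair])
  · intro h
    rw [walkO_apply_of_le F x co h]
    simp [rec6, nthF]

/-! ### The atoms -/

section Atoms

/-- Validity of the final state, one bit. [folklore] -/
def vldT : List Bool → List Bool := vT ∘ finalO F
/-- The final label. [folklore] -/
def labF : List Bool → List Bool := wF ∘ finalO F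
/-- The acceptance bit (wire `0` of the final label). [folklore] -/
def acpT : List Bool → List Bool := bitT (labF F)
/-- The final phase plus `k`, modulo `8`, in unary. [folklore] -/
def phkF (k : ℕ) : List Bool → List Bool := addPh k ∘ finalO F
/-- Round `t` is live (a gate is ahead). [folklore] -/
def liveT : List Bool → List Bool := notFn (nilT (eF ∘ walkO F))
/-- Gate `t` is an oracle gate. [folklore] -/
def orcT : List Bool → List Bool := andFn (liveT F) (tagT ∘ walkO F)
/-- Gate `t` is a Hadamard gate (live, tag `0`, empty symbol code). [folklore] -/
def hadT : List Bool → List Bool := andFn (liveT F) (andFn (notFn (tagT ∘ walkO F)) (nilT (opF ∘ walkO F)))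
/-- The coin read in round `t` (the guessed answer at an oracle gate). [folklore] -/
def coinT : List Bool → List Bool := cT ∘ walkO F
/-- The query string of round `t` (meaningful at an oracle gate). [cite: AaronsonAmbainis2014, proof of Thm. 23 (p. 14)] -/
def qryF : List Bool → List Bool := qF ∘ walkO F
/-- The canonical number `strNum` of the query of round `t`: `val (q·1) − 1`. [folklore] -/
def idxF : List Bool → List Bool :=
  subFn ∘ pr (OracleCompose.concatFn ∘ pr (qryF F) (fun _ => [true])) (fun _ => [true])

variable {F}

/-- All atoms are in `FP` for a uniform family. [cite: AroraBarak2009, §1.3, §6.2] -/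
theorem atoms_mem_FP (hU : F.IsUniform) :
    vldT F ∈ FP ∧ labF F ∈ FP ∧ acpT F ∈ FP ∧ (∀ k, phkF F k ∈ FP) ∧ liveT F ∈ FP ∧ orcT F ∈ FP ∧ hadT F ∈ FP ∧
      coinT F ∈ FP ∧ qryF F ∈ FP ∧ idxF F ∈ FP := by
  have hf := finalO_mem_FP F hU
  have hw := walkO_mem_FP F hU
  have hlive : liveT F ∈ FP := notFn_mem_FP (nilT_mem_FP (comp_mem_FP (nthF_mem_FP 1) hw))
  have hq : qryF F ∈ FP := comp_mem_FP qF_mem_FP hw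
  refine ⟨comp_mem_FP vT_mem_FP hf, comp_mem_FP (nthF_mem_FP 3) hf, bitT_mem_FP (comp_mem_FP (nthF_mem_FP 3) hf),
    fun k => comp_mem_FP (addPh_mem_FP k) hf, hlive, andFn_mem_FP hlive (comp_mem_FP tagT_mem_FP hw),
    andFn_mem_FP hlive (andFn_mem_FP (notFn_mem_FP (comp_mem_FP tagT_mem_FP hw)) (nilT_mem_FP (comp_mem_FP opF_mem_FP hw))),
    comp_mem_FP cT_mem_FP hw, hq, ?_⟩
  exact comp_mem_FP subFn_mem_FP (fanoutFn_mem_FP (comp_mem_FP OracleCompose.concatFn_mem_FP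
    (fanoutFn_mem_FP hq (const_mem_FP _))) (const_mem_FP _))

variable (F) (x c : List Bool)

/-- The final guessed state of the coins `c`. [folklore] -/
abbrev stO : TState (x.length + F.ancillas x.length) := tRunO (F.circ x.length).gates c (w₀ F x, 0, true)

/-- The label before round `t`. [folklore] -/
abbrev labAt (t : ℕ) : QReg (x.length + F.ancillas x.length) :=
  (tRunO ((F.circ x.length).gates.take t) c (w₀ F x, 0, true)).1

/-- **Value of `vldT`**: the validity flag. [folklore] -/
theorem vldT_apply : vldT F (boolPair x c) = [(stO F x c).2.2] := by
  simp only [vldT, Function.comp_apply, finalO_apply, vT_apply]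
  simp [rec6, sndPow]

/-- **Value of `labF`**: the final label. [folklore] -/
theorem labF_apply : labF F (boolPair x c) = List.ofFn (stO F x c).1 := by
  simp only [labF, Function.comp_apply, finalO_apply]
  simp [rec6, nthF]

/-- **Value of `acpT`**: the bit on wire `0` (acceptance), `0` on the empty register. [folklore] -/
theorem accT_apply : acpT F (boolPair x c) = [headBit (List.ofFn (stO F x c).1)] := by
  rw [acpT, bitT_apply, labF_apply]

/-- **Value of `phkF k`**: `1^{(φ + k) mod 8}`. [folklore] -/
theorem phkF_apply (k : ℕ) : phkF F k (boolPair x c) = ones (((stO F x c).2.1 + k) % 8) := by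
  simp only [phkF, Function.comp_apply, addPh_apply, finalO_apply]
  simp [rec6, nthF]

/-- **Value of `liveT`**: `[t < μ]`. [folklore] -/
theorem liveT_apply (t : ℕ) :
    liveT F (boolPair x (boolPair c (encodeNat t))) = [decide (t < (F.circ x.length).gates.length)] := by
  rw [liveT, notFn_apply (nilT_apply _ _)]
  simp only [Function.comp_apply, eF_walkO_eq_nil_iff]
  by_cases h : t < (F.circ x.length).gates.length
  · simp [h, not_le.2 h]
  · simp [h, not_lt.1 h]

/-- The record before round `t < μ`, with the code of gate `t` ahead. [folklore] -/
theorem walkO_apply_lt {t : ℕ} (ht : t < (F.circ x.length).gates.length) :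
    walkO F (boolPair x (boolPair c (encodeNat t))) =
      rec6 (F.descFn x) (encList (((F.circ x.length).gates[t]).encode :: (((F.circ x.length).gates.drop (t + 1)).map QGate.encode)))
        (c.drop t) (List.ofFn (labAt F x c t)) (ones (tRunO ((F.circ x.length).gates.take t) c (w₀ F x, 0, true)).2.1)
        [(tRunO ((F.circ x.length).gates.take t) c (w₀ F x, 0, true)).2.2] := by
  rw [walkO_apply F x c ht.le]
  simp only [List.drop_eq_getElem_cons ht, List.map_cons]

/-- The tag bit of a record whose next code is that of a gate symbol is `0`. [folklore] -/
theorem headBit_gF_rec6_gate (d : List Bool) (L : List (List Bool)) (co wl ph v : List Bool) (op : CliffordTOp)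
    (e : Fin (cliffordT.arity op) ↪ Fin N) :
    headBit (gF (rec6 d (encList ((QGate.gate op e : QGate cliffordT N).encode :: L)) co wl ph v)) = false := by
  rw [encList_cons]; cases op <;> simp [gF, nthF, QGate.encode]

/-- The symbol code of a record whose next code is that of a gate symbol is empty iff the gate is `H`. [folklore] -/
theorem opF_rec6_gate_eq_nil_iff (d : List Bool) (L : List (List Bool)) (co wl ph v : List Bool) (op : CliffordTOp)
    (e : Fin (cliffordT.arity op) ↪ Fin N) :
    opF (rec6 d (encList ((QGate.gate op e : QGate cliffordT N).encode :: L)) co wl ph v) = [] ↔ op = CliffordTOp.H := by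
  cases op with
  | H => rw [encode_gateH]; simp [opF, gtF, gF, nthF, encList_cons]
  | S => rw [encode_gateS]; simp [opF, gtF, gF, nthF, encList_cons]
  | T => rw [encode_gateT]; simp [opF, gtF, gF, nthF, encList_cons]
  | CNOT => rw [encode_gateCNOT]; simp [opF, gtF, gF, nthF, encList_cons]

/-- **Value of `orcT`**: gate `t` exists and is an oracle gate. [folklore] -/
theorem orcT_apply (t : ℕ) :
    orcT F (boolPair x (boolPair c (encodeNat t))) = [(((F.circ x.length).gates[t]?).map isOracleB).getD false] := by
  have htag : (tagT ∘ walkO F) (boolPair x (boolPair c (encodeNat t))) = [headBit (gF (walkO F (boolPair x (boolPair c (encodeNat t)))))] := by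
    simp [tagT]
  rw [orcT, andFn_apply (liveT_apply F x c t) htag]
  by_cases ht : t < (F.circ x.length).gates.length
  · rw [List.getElem?_eq_getElem ht, Option.map_some, Option.getD_some, walkO_apply_lt F x c ht, decide_eq_true ht, Bool.true_and]
    generalize (F.circ x.length).gates[t] = g
    cases g with
    | gate op e => rw [headBit_gF_rec6_gate]; rfl
    | oracle k e =>
      obtain ⟨-, htg, -⟩ := opieces_rec6 (F.descFn x) (((F.circ x.length).gates.drop (t + 1)).map QGate.encode) (c.drop t)
        (labAt F x c t) (ones (tRunO ((F.circ x.length).gates.take t) c (w₀ F x, 0, true)).2.1)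
        [(tRunO ((F.circ x.length).gates.take t) c (w₀ F x, 0, true)).2.2] e
      rw [htg]; rfl
  · rw [List.getElem?_eq_none (not_lt.1 ht)]
    simp [ht]

/-- **Value of `hadT`**: gate `t` exists and is a Hadamard gate. [folklore] -/
theorem hadT_apply (t : ℕ) :
    hadT F (boolPair x (boolPair c (encodeNat t))) = [(((F.circ x.length).gates[t]?).map QGateIsH).getD false] := by
  have htag : (notFn (tagT ∘ walkO F)) (boolPair x (boolPair c (encodeNat t))) =
      [!headBit (gF (walkO F (boolPair x (boolPair c (encodeNat t)))))] :=
    notFn_apply (by simp [tagT])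
  have hop : (nilT (opF ∘ walkO F)) (boolPair x (boolPair c (encodeNat t))) =
      [decide (opF (walkO F (boolPair x (boolPair c (encodeNat t)))) = [])] := nilT_apply _ _
  rw [hadT, andFn_apply (liveT_apply F x c t) (andFn_apply htag hop)]
  by_cases ht : t < (F.circ x.length).gates.length
  · rw [List.getElem?_eq_getElem ht, Option.map_some, Option.getD_some, walkO_apply_lt F x c ht, decide_eq_true ht, Bool.true_and]
    generalize (F.circ x.length).gates[t] = g
    cases g with
    | gate op e =>
      rw [headBit_gF_rec6_gate]
      by_cases hop' : op = CliffordTOp.H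
      · subst hop'
        rw [decide_eq_true ((opF_rec6_gate_eq_nil_iff _ _ _ _ _ _ _ e).2 rfl)]; rfl
      · rw [decide_eq_false (fun h => hop' ((opF_rec6_gate_eq_nil_iff _ _ _ _ _ _ _ e).1 h))]
        cases op <;> first | exact absurd rfl hop' | rfl
    | oracle k e =>
      obtain ⟨-, htg, -⟩ := opieces_rec6 (F.descFn x) (((F.circ x.length).gates.drop (t + 1)).map QGate.encode) (c.drop t)
        (labAt F x c t) (ones (tRunO ((F.circ x.length).gates.take t) c (w₀ F x, 0, true)).2.1)
        [(tRunO ((F.circ x.length).gates.take t) c (w₀ F x, 0, true)).2.2] e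
      rw [htg]; rfl
  · rw [List.getElem?_eq_none (not_lt.1 ht)]
    simp [ht]

/-- **Value of `coinT`**: the coin of round `t`. [folklore] -/
theorem coinT_apply {t : ℕ} (ht : t < (F.circ x.length).gates.length) :
    coinT F (boolPair x (boolPair c (encodeNat t))) = [c.getD t false] := by
  simp only [coinT, Function.comp_apply, walkO_apply_lt F x c ht, cT, bitT_apply]
  simp [rec6, nthF, headBit_eq_getD]

/-- **Value of `qryF` at an oracle gate**: the query string `queryOf e (label before round t)`. [cite: AaronsonAmbainis2014, proof of Thm. 23 (p. 14)] -/
theorem qryF_apply {t : ℕ} (ht : t < (F.circ x.length).gates.length) {k : ℕ} {e : Fin (k + 1) ↪ Fin (x.length + F.ancillas x.length)}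
    (hg : (F.circ x.length).gates[t] = .oracle k e) :
    qryF F (boolPair x (boolPair c (encodeNat t))) = queryOf e (labAt F x c t) := by
  simp only [qryF, Function.comp_apply, walkO_apply_lt F x c ht, hg]
  exact (opieces_rec6 (F.descFn x) _ (c.drop t) (labAt F x c t) _ _ e).2.2.2.2.2.2.2.2.2.1

/-- **Value of `idxF` at an oracle gate**: the canonical number of the query. [folklore] -/
theorem idxF_apply {t : ℕ} (ht : t < (F.circ x.length).gates.length) {k : ℕ} {e : Fin (k + 1) ↪ Fin (x.length + F.ancillas x.length)}
    (hg : (F.circ x.length).gates[t] = .oracle k e) :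
    idxF F (boolPair x (boolPair c (encodeNat t))) = encodeNat (strNum (queryOf e (labAt F x c t))) := by
  simp only [idxF, Function.comp_apply, fanoutFn_apply, qryF_apply F x c ht hg, OracleCompose.concatFn_boolPair, subFn_boolPair,
    strNum]
  rfl

end Atoms

end ADH

end Literature.Computability.QuantumComplexity

end
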